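import Summits.QuantumFields.BalabanUV.T4Continuum.Support.NE7K1LinSchurLineU1

/-!
# NE7K1LinSchurLineU1Sharp — row NE7 (node U5), candidate route HOM, path H1L, cell K1-lin(s): the U = 1 (A = 0)
# TWO-CUTOFF INSTANCE WITH THE ENDPOINTS' OWN CONSTANT — ψ-RESCALING of the complemented coordinates restores the
# floor `γ₀ = min(2,a)` and the prefactor `2∕γ₀` (PRICING-NE7 v16.1 §98 (d) P-v16.1-2: «the loss in σ is NOT intrinsic»)

Lineage `b2b-balaban-t4-ne7-p2` (CRUX PROVER NE7 #2), generation 64; eighth piece of the cell (after p284751, p285160,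
p285751, p285983, p286360, p287307, p288057 ✓).  WHY: `NE7K1LinSchurLineU1.twoCutoff_inv_decay` ran the form version of
Combes–Thomas with the COMMON floor `σ = min(2,a)∕L^{d+1}` (the density ratio `c = L^{−(d+1)}` times the crude bound
`‖Tu‖² ≥ ‖u‖²`) and therefore displayed the prefactor `2L^{d+1}∕min(2,a)`.  The refuter's precision
P-v16.1-2 observed that this loss is NOT intrinsic: the Schur complement `S(H₁) = A₁ − BD⁻¹C` is INVARIANT under rescaling
the complemented (fluctuation) coordinates `ψ ↦ μψ` (`B ↦ μB`, `C ↦ μC`, `D ↦ μ²D`), while `NE7K1LinBlockCoords.sum_sq_block`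
gives the SHARPER split `‖T(V,ψ)‖² ≥ L^{d+1}‖V‖² + ‖ψ‖²`, so with `μ² = L^{d+1}` the rescaled run-B operator
`H_B^{(μ)} = S_μ H_B S_μ` is `c·γ₀·L^{d+1} = γ₀`-coercive — the SAME floor as run A — and the factor moves to the error side
(`‖T S_μ u‖² ≤ L^{2(d+1)}‖u‖²`, conjugation-error constant `L^{d+1}·κ_M`).  THIS FILE does exactly that, in kernel:

* §1 (abstract, [folklore]) `scaleR μ = 1 ⊕ μ·1`; `scaleR_mul_mul_scaleR` (blocks `(H₁₁, μH₁₂, μH₂₁, μ²H₂₂)`);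
  **`lineOpR_rescale`**: `lineOpR P₀ A₁ (μB) (μC) (μ²D) s = lineOpR P₀ A₁ B C D s` (`μ ≠ 0`) — the LINE `twoCutoffLine` is
  UNCHANGED by the rescaling, so the theorem below is about the SAME object as p287307's;
* §2 `coordTμ = coordT · S_μ`, `runBμ = c·(T S_μ)ᵀ M (T S_μ) = S_μ·runB·S_μ` (`lineOpR_runBμ`: its Schur line is `twoCutoffLine`);
  `L^{d+1}‖u‖² ≤ ‖T S_μ u‖² ≤ L^{2(d+1)}‖u‖²` at `μ² = L^{d+1}` (`dot_le_coordTμ`, `coordTμ_le_dot`, `#NZ + 1 ≤ L^{d+1}`); `coordTμ_compat`;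
* §3 **`twoCutoff_inv_decay_sharp`**: for `a > 0`, `n ≥ 1`, `L ≥ 1`, `R′` a union of `nL`-blocks, `0 ≤ δ ≤ 1` with
  `L^{d+1}·(2(d+1)δ²L² + a(e^δ − 1)) ≤ min(2,a)∕2`, `s ∈ [0,1]`: `|(twoCutoffLine s)⁻¹(x,y)| ≤ (2∕min(2,a))·e^{−δ·(1∕n)|x−y|_∞}`
  — prefactor `2∕γ₀` EQUAL to the endpoints' own (`B4Lower18.green_entry_decay_region`), mesh- and `s`-uniform; window WIDER
  than p287307's by a factor 2, prefactor better by `L^{d+1}`; **`twoCutoff_inv_decay'`** = p287307's statement with the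
  improved constant under p287307's own hypothesis (strict improvement, same object).

Displayed letters (PRICING-NE7 v16 §94 (d) (f2)∕(f4), P-v16.1-2): `c = L^{−(d+1)}` (density ratio, NOT free), `μ² = L^{d+1}`,
`c_{TS} = L^{d+1}`, `C_{TS} = L^{2(d+1)}`, `σ = c·γ₀·c_{TS} = γ₀`, `κ_{H_B^{(μ)}} = c·κ_M·C_{TS} = L^{d+1}(2(d+1)δ²L² + a(e^δ−1)) ≤ γ₀∕2`
⇒ `δ(L) ≍ L^{−(d+3)∕2}(γ₀∕(4(d+1)))^{1∕2}` — constants depending on `d, L, a` only, none on the mesh or on `s`.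

HONEST FRAMING: Gaussian `A = 0` level only (no background field, no gauge group, no minimisers, no R-operation); L^∞ half
of (1.10) and the multi-scale (1.7) factor not here (template, PARAMETRIC); [folklore] over the tree's B4 certificates; nothing
printed asserted; no `sorry`.  FIXED FINITE T⁴, rung (B)+1; NE7 NOT PRINTED ∕ NOT PROVED; spine 0∕9; NOT infinite volume, NOT
mass gap, NOT Clay.  HONEST DEPENDENCY: continuum YM on T⁴ ⇐ BetaPertH ∧ nine spine estimates (0/9 proved); BetaPertH ⇐
(D1) ∧ (D4) ∧ CAP+tail; G-an2-4 gates asym, D1 and NE2/3/4.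
-/

noncomputable section

open Finset Matrix

namespace Summit.QuantumFields.BalabanUV.T4Continuum.NE7K1LinSchurLineU1Sharp

open Literature.MathematicalPhysics.QuantumFieldTheory.Balaban1983to89
open Literature.MathematicalPhysics.QuantumFieldTheory.Balaban1983to89.B4ContourShift (supNorm supNorm_nonneg abs_le_supNorm)
open Literature.MathematicalPhysics.QuantumFieldTheory.Balaban1983to89.B4Reflection242
open Literature.MathematicalPhysics.QuantumFieldTheory.Balaban1983to89.B4BoxCov237
open Literature.MathematicalPhysics.QuantumFieldTheory.Balaban1983to89.B4Lower18
open Literature.MathematicalPhysics.QuantumFieldTheory.Balaban1983to89.B4Thm110ZeroBox (blk_blk)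
open NE7K1LinSchurLineForm NE7K1LinSchurLineCoords NE7K1LinFineOpWeight NE7K1LinBlockCoords NE7K1LinSchurLineU1

variable {d : ℕ}

/-! ### §1 Abstract: rescaling the complemented coordinates leaves the Schur line unchanged -/

section Rescale

variable (ιc ιf : Type*) [DecidableEq ιc] [DecidableEq ιf]

/-- the ψ-rescaling `S_μ = 1 ⊕ μ·1` on coarse ⊕ fine. [folklore] -/
def scaleR (μ : ℝ) : Matrix (ιc ⊕ ιf) (ιc ⊕ ιf) ℝ := fromBlocks 1 0 0 (μ • (1 : Matrix ιf ιf ℝ))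

/-- `S_μ` is symmetric. [folklore] -/
theorem scaleR_transpose (μ : ℝ) : (scaleR ιc ιf μ)ᵀ = scaleR ιc ιf μ := by
  simp only [scaleR, fromBlocks_transpose, transpose_one, transpose_zero, transpose_smul]

variable {ιc ιf}

/-- `S_μ` is diagonal: its off-diagonal entries vanish. [folklore] -/
theorem scaleR_apply_ne (μ : ℝ) {c c' : ιc ⊕ ιf} (h : c' ≠ c) : scaleR ιc ιf μ c' c = 0 := by
  rcases c with c | c <;> rcases c' with c' | c'
  · simp only [scaleR, fromBlocks_apply₁₁, Matrix.one_apply, ite_eq_right_iff]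
    exact fun h' => absurd (congrArg Sum.inl h') h
  · simp only [scaleR, fromBlocks_apply₂₁, Matrix.zero_apply]
  · simp only [scaleR, fromBlocks_apply₁₂, Matrix.zero_apply]
  · simp only [scaleR, fromBlocks_apply₂₂, Matrix.smul_apply, Matrix.one_apply, smul_eq_mul, mul_ite, mul_one,
      mul_zero, ite_eq_right_iff]
    exact fun h' => absurd (congrArg Sum.inr h') h

/-- `S_μ` acts as the identity on the coarse coordinates and as `μ` on the fine ones. [folklore] -/
theorem scaleR_mulVec [Fintype ιc] [Fintype ιf] (μ : ℝ) (u : ιc ⊕ ιf → ℝ) :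
    (scaleR ιc ιf μ).mulVec u = Sum.elim (u ∘ Sum.inl) (μ • (u ∘ Sum.inr)) := by
  simp only [scaleR, fromBlocks_mulVec, one_mulVec, zero_mulVec, add_zero, zero_add, smul_mulVec, one_mulVec]

/-- the blocks of `S_μ H S_μ` are `(H₁₁, μH₁₂, μH₂₁, μ²H₂₂)`. [folklore] -/
theorem scaleR_mul_mul_scaleR [Fintype ιc] [Fintype ιf] (μ : ℝ) (H : Matrix (ιc ⊕ ιf) (ιc ⊕ ιf) ℝ) :
    scaleR ιc ιf μ * H * scaleR ιc ιf μ =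
      fromBlocks H.toBlocks₁₁ (μ • H.toBlocks₁₂) (μ • H.toBlocks₂₁) (μ ^ 2 • H.toBlocks₂₂) := by
  conv_lhs => rw [← fromBlocks_toBlocks H]
  simp only [scaleR, fromBlocks_multiply, Matrix.one_mul, Matrix.mul_one, Matrix.zero_mul, Matrix.mul_zero, add_zero,
    zero_add, Matrix.smul_mul, Matrix.mul_smul, smul_smul, sq]

/-- the inverse of a rescaled matrix: `(r•D)⁻¹ = r⁻¹•D⁻¹` for `r ≠ 0` (both sides `0` when `D` is singular). [folklore] -/
theorem inv_smul_eq [Fintype ιf] {r : ℝ} (hr : r ≠ 0) (D : Matrix ιf ιf ℝ) : (r • D)⁻¹ = r⁻¹ • D⁻¹ := by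
  by_cases hD : IsUnit D.det
  · exact Matrix.inv_eq_right_inv (by
      rw [Matrix.smul_mul, Matrix.mul_smul, smul_smul, mul_nonsing_inv _ hD, mul_inv_cancel₀ hr, one_smul])
  · have h1 : ¬ IsUnit (r • D).det := by
      rw [det_smul]
      exact fun h => hD (IsUnit.mul_iff.1 h).2
    rw [nonsing_inv_apply_not_isUnit _ hD, nonsing_inv_apply_not_isUnit _ h1, smul_zero]

omit [DecidableEq ιc] in
/-- **THE SCHUR LINE IS INVARIANT UNDER ψ-RESCALING**: `(μB)(μ²D)⁻¹(μC) = BD⁻¹C`, hence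
`lineOpR P₀ A₁ (μB) (μC) (μ²D) s = lineOpR P₀ A₁ B C D s` (`μ ≠ 0`). [folklore] -/
theorem lineOpR_rescale [Fintype ιf] (P₀ A₁ : Matrix ιc ιc ℝ) (B : Matrix ιc ιf ℝ) (C : Matrix ιf ιc ℝ)
    (D : Matrix ιf ιf ℝ) {μ : ℝ} (hμ : μ ≠ 0) (s : ℝ) :
    lineOpR P₀ A₁ (μ • B) (μ • C) (μ ^ 2 • D) s = lineOpR P₀ A₁ B C D s := by
  have key : (μ • B) * (μ ^ 2 • D)⁻¹ * (μ • C) = B * D⁻¹ * C := by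
    rw [inv_smul_eq (pow_ne_zero 2 hμ)]
    simp only [Matrix.smul_mul, Matrix.mul_smul, smul_smul]
    rw [show μ * ((μ ^ 2)⁻¹ * μ) = 1 by field_simp, one_smul]
  simp only [lineOpR, key]

end Rescale

/-! ### §2 The ψ-rescaled block coordinates and run B's operator in them -/

section TwoCutoffSharp

variable {n L : ℕ} [NeZero L] {R' : Finset (Fin (d + 1) → ℤ)}

/-- the ψ-rescaled block coordinates `T S_μ : (V, ψ) ↦ T(V, μψ)`. [folklore] -/
def coordTμ (hR'L : IsBlockUnion L R') (μ : ℝ) :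
    Matrix ↥R' (↥(R'.image (blk L)) ⊕ (↥(R'.image (blk L)) × NZ d L)) ℝ :=
  coordT hR'L * scaleR (↥(R'.image (blk L))) (↥(R'.image (blk L)) × NZ d L) μ

/-- run B's step operator in the ψ-rescaled block coordinates `(L^{d+1})⁻¹·(T S_μ)ᵀ·fineOpR (nL) a 0 R′·(T S_μ)`. [folklore] -/
def runBμ (hR'L : IsBlockUnion L R') (n : ℕ) (a μ : ℝ) :
    Matrix (↥(R'.image (blk L)) ⊕ (↥(R'.image (blk L)) × NZ d L)) (↥(R'.image (blk L)) ⊕ (↥(R'.image (blk L)) × NZ d L)) ℝ :=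
  (((L : ℝ) ^ (d + 1))⁻¹) • ((coordTμ hR'L μ)ᵀ * fineOpR (n * L) a 0 R' * coordTμ hR'L μ)

/-- `H_B^{(μ)} = S_μ·H_B·S_μ`. [folklore] -/
theorem runBμ_eq (hR'L : IsBlockUnion L R') (n : ℕ) (a μ : ℝ) :
    runBμ hR'L n a μ = scaleR (↥(R'.image (blk L))) (↥(R'.image (blk L)) × NZ d L) μ * runB hR'L n a * scaleR (↥(R'.image (blk L))) (↥(R'.image (blk L)) × NZ d L) μ := by
  rw [runBμ, runB, coordTμ, transpose_mul, scaleR_transpose]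
  simp only [Matrix.mul_smul, Matrix.smul_mul, Matrix.mul_assoc]

/-- the blocks of `H_B^{(μ)}`: `(A₁, μB, μC, μ²D)` in terms of those of `H_B`. [folklore] -/
theorem runBμ_blocks (hR'L : IsBlockUnion L R') (n : ℕ) (a μ : ℝ) :
    (runBμ hR'L n a μ).toBlocks₁₁ = (runB hR'L n a).toBlocks₁₁ ∧
      (runBμ hR'L n a μ).toBlocks₁₂ = μ • (runB hR'L n a).toBlocks₁₂ ∧
        (runBμ hR'L n a μ).toBlocks₂₁ = μ • (runB hR'L n a).toBlocks₂₁ ∧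
          (runBμ hR'L n a μ).toBlocks₂₂ = μ ^ 2 • (runB hR'L n a).toBlocks₂₂ := by
  have h := runBμ_eq hR'L n a μ
  rw [scaleR_mul_mul_scaleR] at h
  exact ⟨by rw [h, toBlocks_fromBlocks₁₁], by rw [h, toBlocks_fromBlocks₁₂], by rw [h, toBlocks_fromBlocks₂₁],
    by rw [h, toBlocks_fromBlocks₂₂]⟩

/-- **THE LINE IS THE SAME**: the Schur line built from `H_B^{(μ)}`'s blocks is `twoCutoffLine` (`μ ≠ 0`). [folklore] -/
theorem lineOpR_runBμ (hR'L : IsBlockUnion L R') (n : ℕ) (a : ℝ) {μ : ℝ} (hμ : μ ≠ 0) (s : ℝ) :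
    lineOpR (runA n L a R') (runBμ hR'L n a μ).toBlocks₁₁ (runBμ hR'L n a μ).toBlocks₁₂ (runBμ hR'L n a μ).toBlocks₂₁
      (runBμ hR'L n a μ).toBlocks₂₂ s = twoCutoffLine hR'L n a s := by
  obtain ⟨h11, h12, h21, h22⟩ := runBμ_blocks hR'L n a μ
  rw [h11, h12, h21, h22, lineOpR_rescale _ _ _ _ _ hμ, twoCutoffLine]

/-- `(T S_μ)u = T(S_μ u)`. [folklore] -/
theorem coordTμ_mulVec (hR'L : IsBlockUnion L R') (μ : ℝ)
    (u : ↥(R'.image (blk L)) ⊕ (↥(R'.image (blk L)) × NZ d L) → ℝ) :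
    (coordTμ hR'L μ).mulVec u = (coordT hR'L).mulVec ((scaleR (↥(R'.image (blk L))) (↥(R'.image (blk L)) × NZ d L) μ).mulVec u) := by
  rw [coordTμ, mulVec_mulVec]

/-- the number of non-zero offsets: `#NZ + 1 ≤ L^{d+1}`. [folklore] -/
theorem card_NZ_succ_le : (Fintype.card (NZ d L) : ℝ) + 1 ≤ (L : ℝ) ^ (d + 1) := by
  have h1 : Fintype.card (NZ d L) < Fintype.card (Fin (d + 1) → Fin L) :=
    Fintype.card_subtype_lt (p := fun j : Fin (d + 1) → Fin L => j ≠ 0) (x := 0) (by simp)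
  rw [Fintype.card_fun, Fintype.card_fin, Fintype.card_fin] at h1
  exact_mod_cast (h1 : Fintype.card (NZ d L) + 1 ≤ L ^ (d + 1))

/-- `‖T S_μ u‖²` in block coordinates: `Σ_b (L^{d+1}V_b² + μ²(Σ_jψ_{b,j})² + μ²Σ_jψ_{b,j}²)`. [folklore] -/
theorem coordTμ_dot_self (hR'L : IsBlockUnion L R') (μ : ℝ)
    (u : ↥(R'.image (blk L)) ⊕ (↥(R'.image (blk L)) × NZ d L) → ℝ) :
    (coordTμ hR'L μ).mulVec u ⬝ᵥ (coordTμ hR'L μ).mulVec u = ∑ b : ↥(R'.image (blk L)),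
      ((L : ℝ) ^ (d + 1) * u (Sum.inl b) ^ 2 + μ ^ 2 * (∑ j' : NZ d L, u (Sum.inr (b, j'))) ^ 2 +
        μ ^ 2 * ∑ j' : NZ d L, u (Sum.inr (b, j')) ^ 2) := by
  rw [coordTμ_mulVec, coordT_dot_self]
  refine Finset.sum_congr rfl fun b _ => ?_
  simp only [scaleR_mulVec, Sum.elim_inl, Sum.elim_inr, Function.comp_apply, Pi.smul_apply, smul_eq_mul]
  rw [← Finset.mul_sum, Finset.mul_sum (a := μ ^ 2)]
  congr 1
  · ring
  · exact Finset.sum_congr rfl fun j _ => by ring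

/-- **LOWER BOUND at `μ² = L^{d+1}`**: `L^{d+1}‖u‖² ≤ ‖T S_μ u‖²` (drop the `S_b²` term of `sum_sq_block`). [folklore] -/
theorem dot_le_coordTμ (hR'L : IsBlockUnion L R') {μ : ℝ} (hμ : μ ^ 2 = (L : ℝ) ^ (d + 1))
    (u : ↥(R'.image (blk L)) ⊕ (↥(R'.image (blk L)) × NZ d L) → ℝ) :
    (L : ℝ) ^ (d + 1) * (u ⬝ᵥ u) ≤ (coordTμ hR'L μ).mulVec u ⬝ᵥ (coordTμ hR'L μ).mulVec u := by
  rw [dot_self_coords, coordTμ_dot_self, hμ, Finset.mul_sum]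
  refine Finset.sum_le_sum fun b _ => ?_
  have hL0 : (0 : ℝ) ≤ (L : ℝ) ^ (d + 1) := by positivity
  nlinarith [mul_nonneg hL0 (sq_nonneg (∑ j' : NZ d L, u (Sum.inr (b, j'))))]

/-- **UPPER BOUND at `μ² = L^{d+1}`**: `‖T S_μ u‖² ≤ L^{2(d+1)}‖u‖²` (`S_b² ≤ #NZ·Σψ²`, `#NZ + 1 ≤ L^{d+1}`). [folklore] -/
theorem coordTμ_le_dot (hR'L : IsBlockUnion L R') {μ : ℝ} (hμ : μ ^ 2 = (L : ℝ) ^ (d + 1))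
    (u : ↥(R'.image (blk L)) ⊕ (↥(R'.image (blk L)) × NZ d L) → ℝ) :
    (coordTμ hR'L μ).mulVec u ⬝ᵥ (coordTμ hR'L μ).mulVec u ≤ ((L : ℝ) ^ (d + 1)) ^ 2 * (u ⬝ᵥ u) := by
  classical
  rw [dot_self_coords, coordTμ_dot_self, hμ, Finset.mul_sum]
  refine Finset.sum_le_sum fun b _ => ?_
  have hCS : (∑ j' : NZ d L, u (Sum.inr (b, j'))) ^ 2 ≤
      (Fintype.card (NZ d L) : ℝ) * ∑ j' : NZ d L, u (Sum.inr (b, j')) ^ 2 := by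
    have := sq_sum_le_card_mul_sum_sq (s := (Finset.univ : Finset (NZ d L))) (f := fun j' => u (Sum.inr (b, j')))
    simpa [Finset.card_univ] using this
  have hψ0 : 0 ≤ ∑ j' : NZ d L, u (Sum.inr (b, j')) ^ 2 := Finset.sum_nonneg fun _ _ => sq_nonneg _
  have hL0 : (0 : ℝ) ≤ (L : ℝ) ^ (d + 1) := by positivity
  have hL1 : (1 : ℝ) ≤ (L : ℝ) ^ (d + 1) := one_le_pow₀ (by exact_mod_cast (NeZero.one_le : 1 ≤ L))
  have hcard := card_NZ_succ_le (d := d) (L := L)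
  have h1 : (∑ j' : NZ d L, u (Sum.inr (b, j'))) ^ 2 + ∑ j' : NZ d L, u (Sum.inr (b, j')) ^ 2 ≤
      (L : ℝ) ^ (d + 1) * ∑ j' : NZ d L, u (Sum.inr (b, j')) ^ 2 := by
    nlinarith [mul_le_mul_of_nonneg_right hcard hψ0]
  nlinarith [mul_le_mul_of_nonneg_left h1 hL0, sq_nonneg (u (Sum.inl b)),
    mul_le_mul_of_nonneg_right hL1 (mul_nonneg hL0 (sq_nonneg (u (Sum.inl b))))]

/-- **WEIGHT COMPATIBILITY of `T S_μ`**: a nonzero entry forces the fine point into the block of the label's site. [folklore] -/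
theorem coordTμ_compat (hR'L : IsBlockUnion L R') (μ : ℝ) (x' : ↥R')
    (c : ↥(R'.image (blk L)) ⊕ (↥(R'.image (blk L)) × NZ d L)) (h : coordTμ hR'L μ x' c ≠ 0) :
    rblk L R' x' = site c := by
  refine coordT_compat hR'L x' c ?_
  have hc : coordTμ hR'L μ x' c = coordT hR'L x' c * scaleR (↥(R'.image (blk L))) (↥(R'.image (blk L)) × NZ d L) μ c c := by
    rw [coordTμ, Matrix.mul_apply]
    exact Finset.sum_eq_single c (fun c' _ hc' => by rw [scaleR_apply_ne μ hc', mul_zero])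
      (fun h => absurd (Finset.mem_univ _) h)
  intro h0
  exact h (by rw [hc, h0, zero_mul])

/-! ### §3 The sharp two-cutoff decay -/

/-- **THE U = 1 TWO-CUTOFF INSTANCE OF K1-lin(s) WITH THE ENDPOINTS' CONSTANT.**  For `a > 0`, `n ≥ 1`, `R′` a union of
`nL`-blocks, `0 ≤ δ ≤ 1` with `L^{d+1}·(2(d+1)δ²L² + a(e^δ − 1)) ≤ min(2,a)∕2` and `s ∈ [0,1]`: the two-cutoff line is
invertible and `|(twoCutoffLine s)⁻¹(x,y)| ≤ (2∕min(2,a))·e^{−δ·edistR n R x y}` — floor `γ₀ = min(2,a)` and prefactor `2∕γ₀`,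
every constant independent of `n` and of `s`.  Route: `lineOpR_inv_decay_form` for `P₀ = runA` and `H₁ = H_B^{(μ)}`,
`μ = √(L^{d+1})`, whose Schur line IS `twoCutoffLine` (`lineOpR_runBμ`). [folklore] -/
theorem twoCutoff_inv_decay_sharp (hn : 1 ≤ n) (hR' : IsBlockUnion (n * L) R') {a δ : ℝ} (ha : 0 < a)
    (hδ0 : 0 ≤ δ) (hδ1 : δ ≤ 1) (hsmall : (L : ℝ) ^ (d + 1) * (2 * ((d : ℝ) + 1) * (δ * L) ^ 2 + a * (Real.exp δ - 1)) ≤ min 2 a / 2)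
    {s : ℝ} (hs0 : 0 ≤ s) (hs1 : s ≤ 1) (x y : ↥(R'.image (blk L))) :
    IsUnit (twoCutoffLine (isBlockUnion_fine hR') n a s).det ∧
      |(twoCutoffLine (isBlockUnion_fine hR') n a s)⁻¹ x y| ≤
        2 / min 2 a * Real.exp (-(δ * edistR n (R'.image (blk L)) x y)) := by
  classical
  have hL : 1 ≤ L := NeZero.one_le
  have hR'L : IsBlockUnion L R' := isBlockUnion_fine hR'
  have hRc : IsBlockUnion n (R'.image (blk L)) := isBlockUnion_coarse hL hR'
  have hnL : 1 ≤ n * L := Nat.one_le_iff_ne_zero.2 (Nat.mul_ne_zero (Nat.one_le_iff_ne_zero.1 hn) (NeZero.ne L))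
  have hn0 : (0 : ℝ) < n := by exact_mod_cast hn
  have hL0 : (0 : ℝ) < L := by exact_mod_cast hL
  have hLpow : (0 : ℝ) < (L : ℝ) ^ (d + 1) := by positivity
  have hmin : 0 < min 2 a := lt_min (by norm_num) ha
  have hexp : 0 ≤ Real.exp δ - 1 := by linarith [Real.add_one_le_exp δ]
  -- the rescaling parameter `μ = √(L^{d+1})`
  set μ : ℝ := Real.sqrt ((L : ℝ) ^ (d + 1)) with hμdef
  have hμ2 : μ ^ 2 = (L : ℝ) ^ (d + 1) := by rw [hμdef, Real.sq_sqrt hLpow.le]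
  have hμ0 : μ ≠ 0 := by
    intro h
    rw [h] at hμ2
    exact hLpow.ne' (by rw [← hμ2]; ring)
  -- the floor `σ = γ₀ = min(2,a)`
  set σ : ℝ := min 2 a with hσdef
  have hσ : 0 < σ := hmin
  set ρ : ↥(R'.image (blk L)) ⊕ (↥(R'.image (blk L)) × NZ d L) → ℝ :=
    fun c => δ * edistR n (R'.image (blk L)) (site c) y with hρ
  set ρ' : ↥R' → ℝ := fun x' => δ * edistR n (R'.image (blk L)) (rblk L R' x') y with hρ'
  -- (1) coercivity of run A
  have hP₀ : ∀ g : ↥(R'.image (blk L)) → ℝ, σ * (g ⬝ᵥ g) ≤ g ⬝ᵥ (runA n L a R').mulVec g :=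
    fun g => lower18_zero hn ha.le hRc g
  -- (2) coercivity of run B in the ψ-RESCALED block coordinates: the SAME floor
  have hH₁ : ∀ u, σ * (u ⬝ᵥ u) ≤ u ⬝ᵥ (runBμ hR'L n a μ).mulVec u := by
    intro u
    have h := coercive_congr (coordTμ hR'L μ) (fineOpR (n * L) a 0 R') (c := ((L : ℝ) ^ (d + 1))⁻¹) (σM := min 2 a)
      (cT := (L : ℝ) ^ (d + 1)) (by positivity) hmin.le (fun φ => lower18_zero hnL ha.le hR' φ) (dot_le_coordTμ hR'L hμ2) u
    have hσ' : ((L : ℝ) ^ (d + 1))⁻¹ * min 2 a * (L : ℝ) ^ (d + 1) = σ := by rw [hσdef]; field_simp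
    rw [hσ'] at h
    exact h
  -- (3) conjugation error of run A at the weight `ρ ∘ inl`
  have hbondA : ∀ x₁ x₂ : ↥(R'.image (blk L)), x₂.1 ∈ nbrs x₁.1 →
      |ρ (Sum.inl x₁) - ρ (Sum.inl x₂)| ≤ δ * (1 / (n : ℝ)) := by
    intro x₁ x₂ h12
    simp only [hρ, site, ← mul_sub, abs_mul, abs_of_nonneg hδ0]
    refine mul_le_mul_of_nonneg_left ((abs_edistR_sub_le x₁ x₂ y).trans ?_) hδ0
    exact (mul_le_mul_of_nonneg_left (supNorm_sub_le_one_of_mem_nbrs h12) (by positivity)).trans (by rw [mul_one])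
  have hblockA : ∀ x₁ x₂ : ↥(R'.image (blk L)), blk n x₁.1 = blk n x₂.1 → |ρ (Sum.inl x₁) - ρ (Sum.inl x₂)| ≤ δ := by
    intro x₁ x₂ h12
    simp only [hρ, site, ← mul_sub, abs_mul, abs_of_nonneg hδ0]
    refine (mul_le_mul_of_nonneg_left ((abs_edistR_sub_le x₁ x₂ y).trans ?_) hδ0).trans (by rw [mul_one])
    calc (1 / (n : ℝ)) * supNorm (x₁.1 - x₂.1) ≤ (1 / (n : ℝ)) * ((n : ℝ) - 1) :=
          mul_le_mul_of_nonneg_left (supNorm_sub_le_of_blk_eq hn h12) (by positivity)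
      _ ≤ 1 := by rw [div_mul_eq_mul_div, one_mul, div_le_one hn0]; linarith
  have h₀ : ∀ g : ↥(R'.image (blk L)) → ℝ, -(σ / 2) * (g ⬝ᵥ g) ≤
      ∑ j, ∑ k, (Real.exp (ρ (Sum.inl j) - ρ (Sum.inl k)) - 1) * runA n L a R' j k * (g j * g k) := by
    intro g
    have hδn : δ * (1 / (n : ℝ)) ≤ 1 := by
      calc δ * (1 / (n : ℝ)) ≤ 1 * 1 :=
            mul_le_mul hδ1 (by rw [div_le_one hn0]; exact_mod_cast hn) (by positivity) zero_le_one
        _ = 1 := one_mul 1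
    have h := conjError_fineOpR_ge hn hRc ha.le hδn hδ0 (fun z => ρ (Sum.inl z)) hbondA hblockA g
    have hg : 0 ≤ g ⬝ᵥ g := by
      simp only [dotProduct]; exact Finset.sum_nonneg fun _ _ => mul_self_nonneg _
    have hκ : 2 * ((d : ℝ) + 1) * δ ^ 2 + a * (Real.exp δ - 1) ≤ σ / 2 := by
      have hL1 : (1 : ℝ) ≤ (L : ℝ) := by exact_mod_cast hL
      have hLp1 : (1 : ℝ) ≤ (L : ℝ) ^ (d + 1) := one_le_pow₀ hL1
      have hδL : δ ^ 2 ≤ (δ * L) ^ 2 := by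
        rw [mul_pow]
        nlinarith [sq_nonneg δ, mul_nonneg (sq_nonneg δ) (by nlinarith : (0 : ℝ) ≤ (L : ℝ) ^ 2 - 1)]
      have hk0 : 0 ≤ 2 * ((d : ℝ) + 1) * (δ * L) ^ 2 + a * (Real.exp δ - 1) := by
        nlinarith [mul_nonneg ha.le hexp, sq_nonneg (δ * L)]
      have hk1 : 2 * ((d : ℝ) + 1) * (δ * L) ^ 2 + a * (Real.exp δ - 1) ≤
          (L : ℝ) ^ (d + 1) * (2 * ((d : ℝ) + 1) * (δ * L) ^ 2 + a * (Real.exp δ - 1)) := by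
        nlinarith [mul_le_mul_of_nonneg_right hLp1 hk0]
      nlinarith [mul_nonneg ha.le hexp, hδL]
    exact le_trans (by nlinarith) h
  -- (4) conjugation error of run B in the rescaled block coordinates at the weight `ρ` (compatible with `ρ'`)
  have hcompat : ∀ x' c, coordTμ hR'L μ x' c ≠ 0 → ρ' x' = ρ c := by
    intro x' c h
    simp only [hρ, hρ', coordTμ_compat hR'L μ x' c h]
  have hbondB : ∀ x₁ x₂ : ↥R', x₂.1 ∈ nbrs x₁.1 → |ρ' x₁ - ρ' x₂| ≤ (δ * L) * (1 / ((n * L : ℕ) : ℝ)) := by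
    intro x₁ x₂ h12
    simp only [hρ', ← mul_sub, abs_mul, abs_of_nonneg hδ0]
    have hkey : (1 / (n : ℝ)) * supNorm ((rblk L R' x₁).1 - (rblk L R' x₂).1) ≤ 1 / (n : ℝ) := by
      have hb : supNorm ((rblk L R' x₁).1 - (rblk L R' x₂).1) ≤ 1 :=
        supNorm_blk_sub_blk_le_one hL (supNorm_sub_le_one_of_mem_nbrs h12)
      exact (mul_le_mul_of_nonneg_left hb (by positivity)).trans (by rw [mul_one])
    have h1 : |edistR n (R'.image (blk L)) (rblk L R' x₁) y - edistR n (R'.image (blk L)) (rblk L R' x₂) y| ≤ 1 / (n : ℝ) :=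
      (abs_edistR_sub_le _ _ y).trans hkey
    have hnL' : (δ * L) * (1 / ((n * L : ℕ) : ℝ)) = δ * (1 / (n : ℝ)) := by
      push_cast
      field_simp
    rw [hnL']
    exact mul_le_mul_of_nonneg_left h1 hδ0
  have hblockB : ∀ x₁ x₂ : ↥R', blk (n * L) x₁.1 = blk (n * L) x₂.1 → |ρ' x₁ - ρ' x₂| ≤ δ := by
    intro x₁ x₂ h12
    simp only [hρ', ← mul_sub, abs_mul, abs_of_nonneg hδ0]
    have hbb : blk n (rblk L R' x₁).1 = blk n (rblk L R' x₂).1 := by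
      show blk n (blk L x₁.1) = blk n (blk L x₂.1)
      rw [blk_blk, blk_blk, Nat.mul_comm]; exact h12
    refine (mul_le_mul_of_nonneg_left ((abs_edistR_sub_le _ _ y).trans ?_) hδ0).trans (by rw [mul_one])
    calc (1 / (n : ℝ)) * supNorm ((rblk L R' x₁).1 - (rblk L R' x₂).1) ≤ (1 / (n : ℝ)) * ((n : ℝ) - 1) :=
          mul_le_mul_of_nonneg_left (supNorm_sub_le_of_blk_eq hn hbb) (by positivity)
      _ ≤ 1 := by rw [div_mul_eq_mul_div, one_mul, div_le_one hn0]; linarith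
  have h₁ : ∀ u, -(σ / 2) * (u ⬝ᵥ u) ≤ ∑ j, ∑ k, (Real.exp (ρ j - ρ k) - 1) * runBμ hR'L n a μ j k * (u j * u k) := by
    intro u
    have hδn : (δ * L) * (1 / ((n * L : ℕ) : ℝ)) ≤ 1 := by
      have : (δ * L) * (1 / ((n * L : ℕ) : ℝ)) = δ * (1 / (n : ℝ)) := by push_cast; field_simp
      rw [this]
      calc δ * (1 / (n : ℝ)) ≤ 1 * 1 :=
            mul_le_mul hδ1 (by rw [div_le_one hn0]; exact_mod_cast hn) (by positivity) zero_le_one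
        _ = 1 := one_mul 1
    have hM := conjError_fineOpR_ge hnL hR' ha.le hδn hδ0 ρ' hbondB hblockB
    have h := conjError_congr_ge (coordTμ hR'L μ) (fineOpR (n * L) a 0 R') (c := ((L : ℝ) ^ (d + 1))⁻¹)
      (κM := 2 * ((d : ℝ) + 1) * (δ * L) ^ 2 + a * (Real.exp δ - 1)) (CT := ((L : ℝ) ^ (d + 1)) ^ 2) (by positivity)
      (by nlinarith [mul_nonneg ha.le hexp, sq_nonneg (δ * L)]) ρ ρ' hcompat
      hM (coordTμ_le_dot hR'L hμ2) u
    have hu : 0 ≤ u ⬝ᵥ u := by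
      simp only [dotProduct]; exact Finset.sum_nonneg fun _ _ => mul_self_nonneg _
    have hκ : ((L : ℝ) ^ (d + 1))⁻¹ * (2 * ((d : ℝ) + 1) * (δ * L) ^ 2 + a * (Real.exp δ - 1)) *
        ((L : ℝ) ^ (d + 1)) ^ 2 ≤ σ / 2 := by
      have heq : ((L : ℝ) ^ (d + 1))⁻¹ * (2 * ((d : ℝ) + 1) * (δ * L) ^ 2 + a * (Real.exp δ - 1)) *
          ((L : ℝ) ^ (d + 1)) ^ 2 = (L : ℝ) ^ (d + 1) * (2 * ((d : ℝ) + 1) * (δ * L) ^ 2 + a * (Real.exp δ - 1)) := by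
        field_simp
      rw [heq, hσdef]
      exact hsmall
    exact le_trans (by nlinarith) h
  -- (5) assemble through the form theorem; the rescaled line IS `twoCutoffLine`
  have hHB : fromBlocks (runBμ hR'L n a μ).toBlocks₁₁ (runBμ hR'L n a μ).toBlocks₁₂ (runBμ hR'L n a μ).toBlocks₂₁
      (runBμ hR'L n a μ).toBlocks₂₂ = runBμ hR'L n a μ := fromBlocks_toBlocks _
  have main := lineOpR_inv_decay_form (runA n L a R') (runBμ hR'L n a μ).toBlocks₁₁ (runBμ hR'L n a μ).toBlocks₁₂
    (runBμ hR'L n a μ).toBlocks₂₁ (runBμ hR'L n a μ).toBlocks₂₂ hσ ρ hP₀ (by rw [hHB]; exact hH₁) h₀ (by rw [hHB]; exact h₁)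
    hs0 hs1
  rw [lineOpR_runBμ hR'L n a hμ0] at main
  refine ⟨main.1, ?_⟩
  have hy : ρ (Sum.inl y) = 0 := by
    simp only [hρ, site, edistR, sub_self, supNorm_zero', mul_zero]
  have h := main.2 x y
  rw [hy, sub_zero] at h
  simpa only [hρ, site] using h

/-- **STRICT IMPROVEMENT OF p287307**: under `twoCutoff_inv_decay`'s OWN window the prefactor is already `2∕min(2,a)`. [folklore] -/
theorem twoCutoff_inv_decay' (hn : 1 ≤ n) (hR' : IsBlockUnion (n * L) R') {a δ : ℝ} (ha : 0 < a)
    (hδ0 : 0 ≤ δ) (hδ1 : δ ≤ 1) (hsmall : 2 * (2 * ((d : ℝ) + 1) * (δ * L) ^ 2 + a * (Real.exp δ - 1)) ≤ (min 2 a / (L : ℝ) ^ (d + 1)) / 2)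
    {s : ℝ} (hs0 : 0 ≤ s) (hs1 : s ≤ 1) (x y : ↥(R'.image (blk L))) :
    IsUnit (twoCutoffLine (isBlockUnion_fine hR') n a s).det ∧
      |(twoCutoffLine (isBlockUnion_fine hR') n a s)⁻¹ x y| ≤
        2 / min 2 a * Real.exp (-(δ * edistR n (R'.image (blk L)) x y)) := by
  have hLpow : (0 : ℝ) < (L : ℝ) ^ (d + 1) := pow_pos (by exact_mod_cast (NeZero.one_le : 1 ≤ L)) _
  have hexp : 0 ≤ Real.exp δ - 1 := by linarith [Real.add_one_le_exp δ]
  refine twoCutoff_inv_decay_sharp hn hR' ha hδ0 hδ1 ?_ hs0 hs1 x y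
  have hk0 : 0 ≤ 2 * ((d : ℝ) + 1) * (δ * L) ^ 2 + a * (Real.exp δ - 1) := by
    nlinarith [mul_nonneg ha.le hexp, sq_nonneg (δ * L)]
  have h1 : (L : ℝ) ^ (d + 1) * (2 * (2 * ((d : ℝ) + 1) * (δ * L) ^ 2 + a * (Real.exp δ - 1))) ≤
      (L : ℝ) ^ (d + 1) * ((min 2 a / (L : ℝ) ^ (d + 1)) / 2) := mul_le_mul_of_nonneg_left hsmall hLpow.le
  have h2 : (L : ℝ) ^ (d + 1) * ((min 2 a / (L : ℝ) ^ (d + 1)) / 2) = min 2 a / 2 := by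
    field_simp
  rw [h2] at h1
  nlinarith [mul_nonneg hLpow.le hk0]

end TwoCutoffSharp

end Summit.QuantumFields.BalabanUV.T4Continuum.NE7K1LinSchurLineU1Sharp
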